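import Summits.AtomisticToContinuum.Crystallization.Theses.DisclinationRation
import Summits.AtomisticToContinuum.Crystallization.Theorems.HullExactificationCascadeHullGoodEverywhereGoodAPI
import Summits.AtomisticToContinuum.Crystallization.Theorems.HullExactificationCascadeHullExactShellsLimits
import Summits.AtomisticToContinuum.Crystallization.Theorems.GappedShellCensusCleanLimitsHaveWindowsMinimalRecurrent
import Literature.MathematicalPhysics.StatisticalMechanics.LocalMatchingCompactness

/-!
# Sketch (crux-ideate, ideator 2, round 1) for crux `HullGlue` — stmt-AtomisticToContinuum-15802

Card `recurrent-clean-hull`: RECURRENCE TRADES DENSITY ZERO FOR ABSENCE.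

Instead of choosing clean cores and re-extracting (birth line), pass ONCE to a rooted-uniformly
recurrent member `Z` of the family of rooted, `δ`-separated, `R₁`-dense hull elements of `x`
whose bad sites have density zero on balls with a fixed modulus `Λ` (the landed Birkhoff theorem
`CleanHull.stub_minimalRecurrent`), and observe that in a uniformly recurrent configuration an
OPEN sitewise defect either is absent or is relatively dense — the latter contradicts density
zero.  Output: `HullGluePlus` = `HullGlue` with `S₂` moreover rooted-uniformly recurrent, and the
abstract lever `forall_not_bad_of_rootedUR` usable for EVERY later exactification of the route
(any translation-covariant, sequentially open defect of density zero is absent from `Z`, with no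
further limit).

Only `hullGlue_of_plus` (the transfer direction `C⁺ → C`) is proved here; the other declarations
are SIGNATURES (first lemmas of the line), each over existing declarations.
-/

noncomputable section

namespace Summit.AtomisticToContinuum.Crystallization.Cruxes.HullGlue.Ideator2

open Filter Topology
open Literature.MathematicalPhysics.StatisticalMechanics
open Summit.AtomisticToContinuum.Crystallization.Theorems

local notation "E3" => EuclideanSpace ℝ (Fin 3)

/-- The route's hull clause `HL x S`, verbatim (named only inside this sketch). -/
def IsHullElt (x : (N : ℕ) → (Fin N → E3)) (S : Set E3) : Prop :=
  ∃ φ : ℕ → ℕ, StrictMono φ ∧ ∃ τ : ℕ → E3, ∀ R ε : ℝ, 0 < ε → ∀ᶠ j : ℕ in atTop,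
    (∀ s ∈ S, ‖s‖ ≤ R → ∃ i : Fin (φ j), dist (x (φ j) i + τ j) s ≤ ε) ∧
    (∀ i : Fin (φ j), ‖x (φ j) i + τ j‖ ≤ R → ∃ s ∈ S, dist (x (φ j) i + τ j) s ≤ ε)

/-- Rooted uniform recurrence — literally the conclusion format of the LANDED
`CleanHull.stub_minimalRecurrent` (Birkhoff: minimal sets are uniformly recurrent): every
`(R, ε)`-patch of `Z` about `0` reappears, up to `ε`, about a point `g ∈ Z` within distance `G`
of every point of `Z`. -/
def RootedUR (Z : Set E3) : Prop :=
  ∀ R ε : ℝ, 0 < ε → ∃ G : ℝ, ∀ w ∈ Z, ∃ g ∈ Z, dist g w ≤ G ∧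
    BallMatch ε R 0 ((fun p => p - g) '' Z) Z

/-- Density zero of the `bad` sites uniformly on balls, with an explicit MODULUS `Λ`
(`θ ↦ L₀`); fixing the modulus is what makes the class closed under local limits. -/
def DensityZeroOnBalls (bad : Set E3 → E3 → Prop) (Λ : ℝ → ℝ) (Z : Set E3) : Prop :=
  ∀ θ : ℝ, 0 < θ → ∀ L : ℝ, Λ θ ≤ L → ∀ c : E3,
    (({y : E3 | y ∈ Z ∧ dist y c ≤ L ∧ bad Z y} : Set E3).ncard : ℝ) ≤ θ * L ^ 3

/-- Translation covariance of a site predicate (for `¬ SiteGood`: landed `SiteGood.translate`). -/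
def TranslationCovariant (bad : Set E3 → E3 → Prop) : Prop :=
  ∀ (Z : Set E3) (y g : E3), bad ((fun p => p - g) '' Z) (y - g) ↔ bad Z y

/-- Sequential OPENNESS of `bad` along based local limits of `δ`-separated, `R₁`-dense sets:
if `Y k → Z` locally, `q k ∈ Y k`, `q k → y ∈ Z` and `y` is bad in `Z`, then `q k` is bad in
`Y k` eventually.  For `bad = ¬ SiteGood` this is the CONTRAPOSITIVE of the closedness of
`1/20`-goodness (birth stub `stub_siteGoodOfLimit`; engine `hge_patternGood_of_limit`, landed).
The density bound `R₁` is needed (it bounds the local scale `d ≤ 3 R₁`). -/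
def SeqOpen (δ R₁ : ℝ) (bad : Set E3 → E3 → Prop) : Prop :=
  ∀ (Y : ℕ → Set E3) (Z : Set E3) (q : ℕ → E3) (y : E3),
    (∀ k, ∀ p ∈ Y k, ∀ p' ∈ Y k, p ≠ p' → δ ≤ dist p p') →
    (∀ p ∈ Z, ∀ p' ∈ Z, p ≠ p' → δ ≤ dist p p') →
    (∀ k, ∀ c : E3, ∃ p ∈ Y k, dist p c ≤ R₁) →
    (∀ R ε : ℝ, 0 < ε → ∀ᶠ k in atTop, BallMatch ε R 0 (Y k) Z) →
    (∀ k, q k ∈ Y k) → Tendsto q atTop (𝓝 y) → y ∈ Z → bad Z y →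
    ∀ᶠ k in atTop, bad (Y k) (q k)

/-! ## FIRST LEMMA (the lever, abstract form): recurrence trades density zero for absence -/

/-- **Recurrence trades density zero for absence.**  Let `bad` be translation covariant and
sequentially open (along based local limits of `δ`-separated `R₁`-dense sets).  If `Z` is
`δ`-separated, `R₁`-dense, rooted-uniformly recurrent, and its bad sites have density zero on
balls, then `Z` has NO bad site.  Proof sketch: if `y₀ ∈ Z` is bad, sequential openness applied
to the re-rootings `Z - g` at finer and finer returns `g` shows that at SOME scale `(n₀, 1/n₀)`
every return `g` (one within `G` of every point of `Z`) carries a bad site within `1/n₀` of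
`g + y₀`; so bad sites are `(G + ‖y₀‖ + 1)`-dense in `Z`, hence number `≥ (L / (2G' + 2))³` in
`B̄_L(0)` — contradicting density zero with `θ < (2G'+2)⁻³`. [Birkhoff/Gottschalk recurrence:
Bergelson 2003 pp. 27–28; Baake–Grimm 2013 Prop. 5.4; folklore otherwise] -/
theorem forall_not_bad_of_rootedUR {bad : Set E3 → E3 → Prop} {δ R₁ : ℝ} {Λ : ℝ → ℝ}
    {Z : Set E3} (hδ : 0 < δ) (hcov : TranslationCovariant bad) (hopen : SeqOpen δ R₁ bad)
    (hsep : ∀ p ∈ Z, ∀ q ∈ Z, p ≠ q → δ ≤ dist p q)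
    (hdense : ∀ c : E3, ∃ p ∈ Z, dist p c ≤ R₁)
    (hrec : RootedUR Z) (hdens : DensityZeroOnBalls bad Λ Z) :
    ∀ y ∈ Z, ¬ bad Z y := by
  sorry

/-- **Instance for the route's predicate.**  A rooted-uniformly recurrent, `δ`-separated,
`R₁`-dense `Z ⊆ ℝ³` whose non-`SiteGood` sites have density zero on balls is EVERYWHERE
`1/20`-{fcc,hcp}-good.  (`hcov` := `SiteGood.translate`, landed; `hopen` := contrapositive of
`stub_siteGoodOfLimit` of the birth line / `hge_patternGood_of_limit`.) -/
theorem siteGood_of_rootedUR {δ R₁ : ℝ} {Λ : ℝ → ℝ} {Z : Set E3} (hδ : 0 < δ)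
    (hsep : ∀ p ∈ Z, ∀ q ∈ Z, p ≠ q → δ ≤ dist p q)
    (hdense : ∀ c : E3, ∃ p ∈ Z, dist p c ≤ R₁) (hrec : RootedUR Z)
    (hdens : DensityZeroOnBalls (fun Z y => ¬ SiteGood Z y) Λ Z) :
    ∀ y ∈ Z, SiteGood Z y := by
  sorry

/-! ## The two supporting statements of the line (signatures) -/

/-- **Upper semicontinuity of the bad census** (the one new technical lemma): along a based
local limit `Y k → Z` of `δ`-separated, `R₁`-dense sets, for every ball and every slack `η > 0`,
eventually the bad sites of `Z` in `B̄_L(c)` inject (via their matching partners, which are bad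
by openness) into the bad sites of `Y k` in `B̄_{L+η}(c)`.  Consequence: `DensityZeroOnBalls`
with a FIXED modulus `Λ` passes to based local limits. -/
theorem ncard_bad_le_of_limit {δ R₁ : ℝ} (hδ : 0 < δ) {Y : ℕ → Set E3} {Z : Set E3}
    (hYsep : ∀ k, ∀ p ∈ Y k, ∀ p' ∈ Y k, p ≠ p' → δ ≤ dist p p')
    (hZsep : ∀ p ∈ Z, ∀ p' ∈ Z, p ≠ p' → δ ≤ dist p p')
    (hYdense : ∀ k, ∀ c : E3, ∃ p ∈ Y k, dist p c ≤ R₁)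
    (hlim : ∀ R ε : ℝ, 0 < ε → ∀ᶠ k in atTop, BallMatch ε R 0 (Y k) Z)
    (L : ℝ) (c : E3) {η : ℝ} (hη : 0 < η) :
    ∀ᶠ k in atTop,
      ({y : E3 | y ∈ Z ∧ dist y c ≤ L ∧ ¬ SiteGood Z y} : Set E3).ncard ≤
        ({y : E3 | y ∈ Y k ∧ dist y c ≤ L + η ∧ ¬ SiteGood (Y k) y} : Set E3).ncard := by
  sorry

/-- **A recurrent member of the hull family.**  The family
`𝒞 := {Z | 0 ∈ Z, δ-separated, hull element of x, R₁-dense, DensityZeroOnBalls ¬SiteGood Λ Z}`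
is non-empty (re-root the given `S` at any of its points: every clause is translation
covariant, the density clause because it is uniform in the centre), closed under re-rooting, and
closed under based `δ`-separated local limits (hull: `HullExactShells.isLimit_of_eventually_ballMatch`;
density radius: closest point of a locally finite set; density modulus: `ncard_bad_le_of_limit`),
so the landed `CleanHull.stub_minimalRecurrent` yields a rooted-uniformly recurrent member. -/
theorem exists_rootedUR_hullElt (x : (N : ℕ) → (Fin N → E3)) {S : Set E3} {δ R₁ : ℝ}
    {Λ : ℝ → ℝ} (hδ : 0 < δ) (hsep : ∀ p ∈ S, ∀ q ∈ S, p ≠ q → δ ≤ dist p q)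
    (hS : IsHullElt x S) (hdense : ∀ c : E3, ∃ p ∈ S, dist p c ≤ R₁)
    (hdens : DensityZeroOnBalls (fun Z y => ¬ SiteGood Z y) Λ S) :
    ∃ Z : Set E3, (0 : E3) ∈ Z ∧ (∀ p ∈ Z, ∀ q ∈ Z, p ≠ q → δ ≤ dist p q) ∧ IsHullElt x Z ∧
      (∀ c : E3, ∃ p ∈ Z, dist p c ≤ R₁) ∧
      DensityZeroOnBalls (fun Z y => ¬ SiteGood Z y) Λ Z ∧ RootedUR Z := by
  sorry

/-! ## The transfer: `C⁺ = HullGluePlus` (recurrent clean hull element) and `C⁺ → HullGlue` -/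

/-- **`HullGluePlus` (C⁺).**  `HullGlue` with the decorative hypotheses (ground states,
alphabet-goodness) dropped and the conclusion STRENGTHENED by rooted uniform recurrence of `S₂`.
Intended proof: `exists_rootedUR_hullElt` (with `Λ` read off the density hypothesis by choice)
then `siteGood_of_rootedUR`. -/
def HullGluePlus : Prop :=
  ∀ (x : (N : ℕ) → (Fin N → E3)) (S : Set E3) (δ : ℝ), 0 < δ →
    (∀ y ∈ S, ∀ z ∈ S, y ≠ z → δ ≤ dist y z) → IsHullElt x S →
    (∃ R₁ : ℝ, ∀ p : E3, ∃ y ∈ S, dist y p ≤ R₁) →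
    (∀ θ : ℝ, 0 < θ → ∃ L₀ : ℝ, ∀ L : ℝ, L₀ ≤ L → ∀ c : E3,
      (({y : E3 | y ∈ S ∧ dist y c ≤ L ∧ ¬ SiteGood S y} : Set E3).ncard : ℝ) ≤ θ * L ^ 3) →
    ∃ S₂ : Set E3, (∀ y ∈ S₂, ∀ z ∈ S₂, y ≠ z → δ ≤ dist y z) ∧ (0 : E3) ∈ S₂ ∧
      IsHullElt x S₂ ∧ (∃ R₁ : ℝ, ∀ p : E3, ∃ y ∈ S₂, dist y p ≤ R₁) ∧
      (∀ y ∈ S₂, SiteGood S₂ y) ∧ RootedUR S₂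

/-- **Transfer direction, PROVED: `C⁺ → HullGlue`** (pure logic; the route's inlined `GF` is
`SiteGood` and its `HL` is `IsHullElt`, both definitionally). -/
theorem hullGlue_of_plus (h : HullGluePlus) :
    Summit.AtomisticToContinuum.Crystallization.Theses.DisclinationRation.HullGlue := by
  intro x _hx S δ hδ hsep hHL hdense _hGA hdens
  obtain ⟨S₂, h1, h2, h3, h4, h5, -⟩ := h x S δ hδ hsep hHL hdense hdens
  exact ⟨S₂, h1, h2, h3, h4, h5⟩

/-- Sanity (PROVED): the modulus form is just a choice function away from the route's clause. -/
theorem densityZeroOnBalls_of_forall {bad : Set E3 → E3 → Prop} {Z : Set E3}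
    (h : ∀ θ : ℝ, 0 < θ → ∃ L₀ : ℝ, ∀ L : ℝ, L₀ ≤ L → ∀ c : E3,
      (({y : E3 | y ∈ Z ∧ dist y c ≤ L ∧ bad Z y} : Set E3).ncard : ℝ) ≤ θ * L ^ 3) :
    ∃ Λ : ℝ → ℝ, DensityZeroOnBalls bad Λ Z := by
  classical
  refine ⟨fun θ => if hθ : 0 < θ then (h θ hθ).choose else 0, fun θ hθ L hL c => ?_⟩
  have hL' : (h θ hθ).choose ≤ L := by simpa [dif_pos hθ] using hL
  exact (h θ hθ).choose_spec L hL' c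

/-- Composition preview (PROVED modulo the three signatures above): `HullGluePlus`. -/
theorem hullGluePlus_of_lemmas : HullGluePlus := by
  intro x S δ hδ hsep hHL hdense hdens
  obtain ⟨R₁, hR₁⟩ := hdense
  obtain ⟨Λ, hΛ⟩ := densityZeroOnBalls_of_forall (bad := fun Z y => ¬ SiteGood Z y) hdens
  obtain ⟨Z, h0, hZsep, hZhull, hZdense, hZdens, hZrec⟩ :=
    exists_rootedUR_hullElt x hδ hsep hHL (fun c => by
      obtain ⟨p, hp, hpc⟩ := hR₁ c
      exact ⟨p, hp, hpc⟩) hΛ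
  exact ⟨Z, hZsep, h0, hZhull, ⟨R₁, fun p => by
    obtain ⟨q, hq, hqp⟩ := hZdense p
    exact ⟨q, hq, hqp⟩⟩, siteGood_of_rootedUR hδ hZsep hZdense hZrec hZdens, hZrec⟩

end Summit.AtomisticToContinuum.Crystallization.Cruxes.HullGlue.Ideator2

end
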